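import Summits.Ventures.DiscreteObjects.Hadamard.InvolutionFolding
import Summits.Ventures.DiscreteObjects.Hadamard.InvolutionCensus668Mod8

/-!
# Hadamard 668 census, family F12 — involutions: type II is empty and type III is 'nega'; the final census (kernel)

Framing: lottery ticket; floor = certified bounds/negative ranges.

Cell pub-namedobj (venture DiscreteObjects), target (H), hadamard gen 13.  Companion of `InvolutionFolding` (folding of the
`+1`-eigenspaces: `no_fpf_involution_pos`) and `InvolutionCensus668Mod8` (type I: `f ≡ 4 (mod 8)`).

* `no_involution_typeII` (GENERAL, `n ≡ 4 (mod 8)`, `n` not a sum of two squares): no signed automorphism `(π, κ, d, e)` with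
  `π` a fixed-point-free involution of sign type `ε = +1` and `κ` an involution with exactly four fixed columns carrying signs
  `+, +, −, −` — the folding matrix uses the column pair vectors together with `e_{j₁} ± e_{j₂}` for the two `+` columns
  (`Vᵀ V = 1 + Q` again), on `n/2 ≡ 2 (mod 4)` coordinates.
* `H(668)`: `hadamard668_fpf_involution_nega` (type III ⇒ `d (π i) = −d i`, `e (κ j) = −e j`: the signed permutation
  matrices square to `−I`), `no_hadamard668_unsigned_fpf_involution`, `hadamard668_no_involution_typeII` (both orientations),
  and the **FINAL INVOLUTION CENSUS** `hadamard668_involution_census_final`: a signed-permutation automorphism `(π, κ, d, e)` of a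
  Hadamard matrix of order `668` with `π² = κ² = 1`, `(π, κ) ≠ (1, 1)` is EITHER of type I — `#Fix π = #Fix κ = f` with
  `f ≡ 4 (mod 8)`, `4 ≤ f ≤ 332`, one common sign on all fixed rows and columns — OR a NEGA fixed-point-free involution —
  no fixed row, no fixed column, `d (π i) = −d i` and `e (κ j) = −e j` for all `i, j`.  (Gen 12's census allowed type II
  `{#Fix π, #Fix κ} = {0, 4}` and type III with either sign type; both `ε = +1` cases are now excluded.)
Consequences: an H(668) has no permutation (unsigned) automorphism acting as a fixed-point-free involution on rows or on
columns; every involution in an unsigned automorphism group fixes `f ≡ 4 (mod 8)` rows, `4 ≤ f ≤ 332`.  Sanity check outside the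
kernel on the Paley `H(12)`: `0` automorphisms with `P` a fixed-point-free involution and `ε = +1` (HOME
`pub-namedobj-hadamard-g13/code/h12_involution_check.py`).  Ours; no `sorry`.
-/

namespace Summit.Ventures.DiscreteObjects.Hadamard

open Finset BigOperators Matrix

open Literature.Combinatorics.Designs.GoethalsSeidel (IsHadamardMatrix)

variable {ι : Type*} [Fintype ι] [DecidableEq ι]

section typeII

/-- **Type II is empty** (ordered index type): `π` fixed-point-free with `ε = +1`, `κ` with exactly four fixed columns
`j₁, j₂` (`e = +1`) and two more (`e = −1`), order `n ≡ 4 (mod 8)` not a sum of two squares ⇒ contradiction. -/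
theorem no_involution_typeII_ord [LinearOrder ι] {H : Matrix ι ι ℤ} {π κ : Equiv.Perm ι} {d e : ι → ℤ}
    (hH : IsHadamardMatrix H) (hn8 : Fintype.card ι % 8 = 4) (hns : ¬ ∃ x y : ℕ, Fintype.card ι = x ^ 2 + y ^ 2)
    (haut : IsSignedAut H π κ d e) (hπinv : ∀ i, π (π i) = i) (hκinv : ∀ j, κ (κ j) = j)
    (hπf : ∀ i, π i ≠ i) (hε : ∀ i, d (π i) = d i) (hfix4 : (univ.filter fun j => κ j = j).card = 4)
    {j₁ j₂ : ι} (hj : j₁ ≠ j₂) (hj₁ : κ j₁ = j₁) (hj₂ : κ j₂ = j₂) (he₁ : e j₁ = 1) (he₂ : e j₂ = 1)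
    (hminus : ∀ j, κ j = j → j ≠ j₁ → j ≠ j₂ → e j = -1) : False := by
  have hd := haut.1
  have he := haut.2.1
  have hεe : ∀ j, e (κ j) = e j := by
    intro j
    obtain ⟨i⟩ : Nonempty ι := Fintype.card_pos_iff.mp (by omega)
    have h := signedAut_sq_sign hH.1 haut hπinv hκinv i j
    rw [hε i, pm_mul_self (hd i), one_mul] at h
    exact (pm_eq_of_mul_eq_one (he j) (he (κ j)) h).symm
  -- representatives
  set R := univ.filter (fun k => π k ≠ k ∧ k < π k) with hRdef
  set C := univ.filter (fun j => κ j ≠ j ∧ j < κ j) with hCdef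
  have h2R : 2 * R.card = Fintype.card ι := by
    rw [two_mul_card_reps π hπinv]
    have : (univ.filter fun i => π i ≠ i) = univ := by
      ext i; simp [hπf i]
    rw [this, Finset.card_univ]
  have h2C : 2 * C.card + 4 = Fintype.card ι := by
    rw [two_mul_card_reps κ hκinv, ← hfix4]
    have h := Finset.card_filter_add_card_filter_not (s := (univ : Finset ι)) (fun j => κ j = j)
    rw [Finset.card_univ] at h
    have eC : (univ.filter fun j => κ j ≠ j) = univ.filter (fun j => ¬ κ j = j) := rfl
    rw [eC]; omega
  have hcardCR : Fintype.card ({j // j ∈ C} ⊕ Fin 2) = Fintype.card {k // k ∈ R} := by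
    rw [Fintype.card_sum, Fintype.card_fin, Fintype.card_coe, Fintype.card_coe]; omega
  obtain ⟨eCR⟩ : Nonempty (({j // j ∈ C} ⊕ Fin 2) ≃ {k // k ∈ R}) := Fintype.card_eq.mp hcardCR
  have hRmod : Fintype.card {k // k ∈ R} % 4 = 2 := by rw [Fintype.card_coe]; omega
  have hsepR : ∀ c c' : {k // k ∈ R}, c.1 ≠ π c'.1 := by
    intro c c' h
    have hc := (Finset.mem_filter.mp c.2).2
    have hc' := (Finset.mem_filter.mp c'.2).2
    have h1 : π c.1 = c'.1 := by rw [h, hπinv]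
    have := hc.2; rw [h1] at this
    have := hc'.2; rw [← h] at this
    exact lt_asymm ‹c.1 < c'.1› ‹c'.1 < c.1›
  have hsepC : ∀ c c' : {j // j ∈ C}, c.1 ≠ κ c'.1 := by
    intro c c' h
    have hc := (Finset.mem_filter.mp c.2).2
    have hc' := (Finset.mem_filter.mp c'.2).2
    have h1 : κ c.1 = c'.1 := by rw [h, hκinv]
    have := hc.2; rw [h1] at this
    have := hc'.2; rw [← h] at this
    exact lt_asymm ‹c.1 < c'.1› ‹c'.1 < c.1›
  have hcovC : ∀ l, κ l ≠ l → ∃ c : {j // j ∈ C}, l = c.1 ∨ l = κ c.1 := by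
    intro l hl
    rcases lt_or_gt_of_ne hl with h | h
    · refine ⟨⟨κ l, Finset.mem_filter.mpr ⟨Finset.mem_univ _, ?_, ?_⟩⟩, Or.inr (hκinv l).symm⟩
      · rw [hκinv]; exact Ne.symm hl
      · rw [hκinv]; exact h
    · exact ⟨⟨l, Finset.mem_filter.mpr ⟨Finset.mem_univ _, hl, h⟩⟩, Or.inl rfl⟩
  -- matrices
  set Hq : Matrix ι ι ℚ := H.map (Int.castRingHom ℚ) with hHqdef
  set P : Matrix ι ι ℚ := fun k i => if k = π i then (d i : ℚ) else 0 with hPdef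
  set Q : Matrix ι ι ℚ := fun l j => if l = κ j then (e j : ℚ) else 0 with hQdef
  set U : Matrix {k // k ∈ R} ι ℚ :=
    fun c i => if i = c.1 then 1 else if i = π c.1 then (d c.1 : ℚ) else 0 with hUdef
  set Vp : Matrix {j // j ∈ C} ι ℚ :=
    fun c l => if l = c.1 then 1 else if l = κ c.1 then (e c.1 : ℚ) else 0 with hVpdef
  set Vx : Matrix (Fin 2) ι ℚ :=
    fun t l => if l = j₁ then 1 else if l = j₂ then (if t = 0 then 1 else -1) else 0 with hVxdef
  set V : Matrix ({j // j ∈ C} ⊕ Fin 2) ι ℚ := fromRows Vp Vx with hVdef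
  set F : Matrix ι ι ℚ := fun l l' => if l = l' ∧ κ l = l then 1 + (e l : ℚ) else 0 with hFdef
  have hHq : Hq * Hqᵀ = ((Fintype.card ι : ℕ) : ℚ) • (1 : Matrix ι ι ℚ) := by
    have h1 : Hq * Hqᵀ = (H * Hᵀ).map (Int.castRingHom ℚ) := by
      rw [Matrix.map_mul, hHqdef, transpose_map]
    rw [h1, hH.2]
    ext i j
    rw [Matrix.map_apply, Matrix.smul_apply, Matrix.smul_apply, Matrix.one_apply, Matrix.one_apply]
    split_ifs <;> simp
  have hPQ : P * Hq = Hq * Q :=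
    sgnPerm_intertwine haut hπinv P Q (fun _ _ => rfl) (fun _ _ => rfl)
  have hUP : U * P = U :=
    pair_mul_sgnPerm π d hπinv hd hε (fun c : {k // k ∈ R} => c.1)
      (fun c => (Finset.mem_filter.mp c.2).2.1) U (fun _ _ => rfl) P (fun _ _ => rfl)
  have hUU : U * Uᵀ = (2 : ℚ) • 1 :=
    pair_mul_transpose π d hd (fun c : {k // k ∈ R} => c.1) hsepR
      (fun c c' h => Subtype.ext h) U (fun _ _ => rfl)
  have hVp : Vpᵀ * Vp = 1 + Q - F :=
    transpose_pair_mul κ e hκinv he hεe (fun c : {j // j ∈ C} => c.1) hsepC (fun c c' h => Subtype.ext h)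
      hcovC Vp (fun _ _ => rfl) Q (fun _ _ => rfl) F (fun _ _ => rfl)
  -- the two extra rows resolve the fixed part: `Vxᵀ Vx = F`
  have hV0 : ∀ m, Vx 0 m = if m = j₁ then 1 else if m = j₂ then 1 else 0 := fun m => by simp [hVxdef]
  have hV1 : ∀ m, Vx 1 m = if m = j₁ then 1 else if m = j₂ then -1 else 0 := fun m => by simp [hVxdef]
  have hVx : Vxᵀ * Vx = F := by
    ext l l'
    rw [Matrix.mul_apply, Fin.sum_univ_two]
    simp only [transpose_apply]
    have hFll' : F l l' = if l = l' ∧ κ l = l then 1 + (e l : ℚ) else 0 := rfl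
    rw [hV0, hV0, hV1, hV1, hFll']
    by_cases h1 : l = j₁
    · simp only [if_pos h1]
      by_cases h1' : l' = j₁
      · simp only [if_pos h1']
        rw [if_pos ⟨h1.trans h1'.symm, by rw [h1, hj₁]⟩, h1, he₁]; norm_num
      · simp only [if_neg h1']
        have hll : ¬ (l = l' ∧ κ l = l) := fun h => h1' (h.1.symm.trans h1)
        rw [if_neg hll]
        by_cases h2' : l' = j₂
        · simp only [if_pos h2']; norm_num
        · simp only [if_neg h2']; norm_num
    · simp only [if_neg h1]
      by_cases h2 : l = j₂
      · simp only [if_pos h2]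
        by_cases h1' : l' = j₁
        · simp only [if_pos h1']
          have hll : ¬ (l = l' ∧ κ l = l) := fun h => hj (h1'.symm.trans (h.1.symm.trans h2))
          rw [if_neg hll]; norm_num
        · simp only [if_neg h1']
          by_cases h2' : l' = j₂
          · simp only [if_pos h2']
            rw [if_pos ⟨h2.trans h2'.symm, by rw [h2, hj₂]⟩, h2, he₂]; norm_num
          · simp only [if_neg h2']
            have hll : ¬ (l = l' ∧ κ l = l) := fun h => h2' (h.1.symm.trans h2)
            rw [if_neg hll]; norm_num
      · simp only [if_neg h2, zero_mul, zero_add]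
        by_cases hll : l = l' ∧ κ l = l
        · rw [if_pos hll, hminus l hll.2 h1 h2]; norm_num
        · rw [if_neg hll]
  have hVV : Vᵀ * V = 1 + Q := by
    rw [hVdef, transpose_fromRows, fromCols_mul_fromRows, hVp, hVx, sub_add_cancel]
  obtain ⟨x, y, hxy⟩ := folding_two_squares Hq P Q U V (Fintype.card ι) hHq hPQ hVV hUP hUU eCR hRmod
  exact hns ⟨x, y, hxy⟩

/-- **Type II is empty.**  For a Hadamard matrix of order `n ≡ 4 (mod 8)`, `n` not a sum of two squares: no signed
automorphism `(π, κ, d, e)` has `π` a fixed-point-free involution, `κ` an involution with exactly four fixed columns whose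
signs sum to `0`, i.e. the shape of type II in `hadamard668_involution_census`.  (`ε = +1` is automatic: a fixed column
`j` has `e j · e (κ j) = 1`.) -/
theorem no_involution_typeII {H : Matrix ι ι ℤ} {π κ : Equiv.Perm ι} {d e : ι → ℤ}
    (hH : IsHadamardMatrix H) (hn8 : Fintype.card ι % 8 = 4) (hns : ¬ ∃ x y : ℕ, Fintype.card ι = x ^ 2 + y ^ 2)
    (haut : IsSignedAut H π κ d e) (hπinv : ∀ i, π (π i) = i) (hκinv : ∀ j, κ (κ j) = j)
    (hπ0 : (univ.filter fun i => π i = i).card = 0) (hκ4 : (univ.filter fun j => κ j = j).card = 4)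
    (hsum : ∑ j ∈ univ.filter (fun j => κ j = j), e j = 0) : False := by
  classical
  have hd := haut.1
  have he := haut.2.1
  have hπf : ∀ i, π i ≠ i := by
    intro i hi
    have : i ∈ univ.filter (fun i => π i = i) := by simp [hi]
    rw [Finset.card_eq_zero.mp hπ0] at this
    simp at this
  -- a fixed column forces ε = +1
  set Fx := univ.filter (fun j => κ j = j) with hFxdef
  have hFxne : Fx.Nonempty := by rw [← Finset.card_pos, hκ4]; norm_num
  obtain ⟨j₀, hj₀⟩ := hFxne
  have hκj₀ : κ j₀ = j₀ := (Finset.mem_filter.mp hj₀).2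
  have hε : ∀ i, d (π i) = d i := by
    intro i
    have h := signedAut_sq_sign hH.1 haut hπinv hκinv i j₀
    rw [hκj₀, pm_mul_self (he j₀), mul_one] at h
    exact (pm_eq_of_mul_eq_one (hd i) (hd (π i)) h).symm
  -- exactly two fixed columns carry `+1`
  have hsplit := Finset.card_filter_add_card_filter_not (s := Fx) (fun j => e j = 1)
  rw [hκ4] at hsplit
  have hm1 : ∀ j ∈ Fx.filter (fun j => ¬ e j = 1), e j = -1 := by
    intro j hj
    have hj' := (Finset.mem_filter.mp hj).2
    rcases he j with h | h
    · exact absurd h hj'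
    · exact h
  have h1 := Finset.sum_filter_add_sum_filter_not Fx (fun j => e j = 1) (fun j => e j)
  rw [hsum, Finset.sum_congr rfl (fun j hj => (Finset.mem_filter.mp hj).2), Finset.sum_congr rfl hm1] at h1
  simp only [Finset.sum_const, mul_one, mul_neg, nsmul_eq_mul] at h1
  have hFp2 : (Fx.filter fun j => e j = 1).card = 2 := by omega
  obtain ⟨j₁, j₂, hj, hFp⟩ := Finset.card_eq_two.mp hFp2
  have hj₁ : j₁ ∈ Fx.filter (fun j => e j = 1) := by rw [hFp]; simp
  have hj₂ : j₂ ∈ Fx.filter (fun j => e j = 1) := by rw [hFp]; simp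
  have hκj₁ : κ j₁ = j₁ := (Finset.mem_filter.mp (Finset.mem_filter.mp hj₁).1).2
  have hκj₂ : κ j₂ = j₂ := (Finset.mem_filter.mp (Finset.mem_filter.mp hj₂).1).2
  have he₁ : e j₁ = 1 := (Finset.mem_filter.mp hj₁).2
  have he₂ : e j₂ = 1 := (Finset.mem_filter.mp hj₂).2
  have hminus : ∀ j, κ j = j → j ≠ j₁ → j ≠ j₂ → e j = -1 := by
    intro j hκj hne1 hne2
    have hjFx : j ∈ Fx := Finset.mem_filter.mpr ⟨Finset.mem_univ _, hκj⟩
    rcases he j with h | h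
    · exfalso
      have : j ∈ Fx.filter (fun j => e j = 1) := Finset.mem_filter.mpr ⟨hjFx, h⟩
      rw [hFp] at this
      simp only [Finset.mem_insert, Finset.mem_singleton] at this
      rcases this with h' | h'
      · exact hne1 h'
      · exact hne2 h'
    · exact h
  letI : LinearOrder ι := LinearOrder.lift' (Fintype.equivFin ι) (Fintype.equivFin ι).injective
  exact no_involution_typeII_ord hH hn8 hns haut hπinv hκinv hπf hε hκ4 hj hκj₁ hκj₂ he₁ he₂ hminus

end typeII

section h668
variable {H : Matrix ι ι ℤ} {π κ : Equiv.Perm ι} {d e : ι → ℤ}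

/-- **H(668): a fixed-point-free involution is 'nega'.**  If `(π, κ, d, e)` is a signed automorphism of a Hadamard matrix
of order `668` with `π² = κ² = 1` fixed-point-free on rows and columns (type III of `hadamard668_involution_census`), then
`d (π i) = −d i` for every row `i` and `e (κ j) = −e j` for every column `j` (`P² = Q² = −I`). -/
theorem hadamard668_fpf_involution_nega (hH : IsHadamardMatrix H) (hι : Fintype.card ι = 668)
    (haut : IsSignedAut H π κ d e) (hπinv : ∀ i, π (π i) = i) (hκinv : ∀ j, κ (κ j) = j)
    (hπf : ∀ i, π i ≠ i) (hκf : ∀ j, κ j ≠ j) :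
    (∀ i, d (π i) = -d i) ∧ (∀ j, e (κ j) = -e j) := by
  have hd := haut.1
  have he := haut.2.1
  have hn8 : Fintype.card ι % 8 = 4 := by rw [hι]
  have hns : ¬ ∃ x y : ℕ, Fintype.card ι = x ^ 2 + y ^ 2 := by rw [hι]; exact not_sq_add_sq_668_nat
  obtain ⟨i₀⟩ : Nonempty ι := Fintype.card_pos_iff.mp (by omega)
  have hsq := signedAut_sq_sign hH.1 haut hπinv hκinv
  by_cases hε0 : d (π i₀) = d i₀
  · exfalso
    have hcol : ∀ j, e (κ j) = e j := by
      intro j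
      have h := hsq i₀ j
      rw [hε0, pm_mul_self (hd i₀), one_mul] at h
      exact (pm_eq_of_mul_eq_one (he j) (he (κ j)) h).symm
    have hrow : ∀ i, d (π i) = d i := by
      intro i
      have h := hsq i i₀
      rw [hcol i₀, pm_mul_self (he i₀), mul_one] at h
      exact (pm_eq_of_mul_eq_one (hd i) (hd (π i)) h).symm
    exact no_fpf_involution_pos hH hn8 hns haut hπinv hκinv hπf hκf hrow
  · have hneg0 : d (π i₀) = -d i₀ := by
      rcases hd (π i₀) with h1 | h1 <;> rcases hd i₀ with h2 | h2 <;> simp_all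
    have hprod0 : d i₀ * d (π i₀) = -1 := by
      rw [hneg0]; have := pm_mul_self (hd i₀); linarith [this, sq_nonneg (d i₀)]
    have hcol : ∀ j, e (κ j) = -e j := by
      intro j
      have h := hsq i₀ j
      rw [hprod0] at h
      have h2 : e j * e (κ j) = -1 := by linarith
      rcases he j with h3 | h3 <;> rcases he (κ j) with h4 | h4 <;> simp_all
    have hrow : ∀ i, d (π i) = -d i := by
      intro i
      have h := hsq i i₀
      have h2 : e i₀ * e (κ i₀) = -1 := by
        rw [hcol i₀]; have := pm_mul_self (he i₀); linarith
      rw [h2] at h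
      have h3 : d i * d (π i) = -1 := by linarith
      rcases hd i with h4 | h4 <;> rcases hd (π i) with h5 | h5 <;> simp_all
    exact ⟨hrow, hcol⟩

/-- **No H(668) has a permutation (unsigned) automorphism pair consisting of fixed-point-free involutions.** -/
theorem no_hadamard668_unsigned_fpf_involution (hH : IsHadamardMatrix H) (hι : Fintype.card ι = 668)
    (haut : IsSignedAut H π κ (fun _ => 1) (fun _ => 1))
    (hπinv : ∀ i, π (π i) = i) (hκinv : ∀ j, κ (κ j) = j) (hπf : ∀ i, π i ≠ i) (hκf : ∀ j, κ j ≠ j) : False := by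
  obtain ⟨i⟩ : Nonempty ι := Fintype.card_pos_iff.mp (by rw [hι]; norm_num)
  have h := (hadamard668_fpf_involution_nega hH hι haut hπinv hκinv hπf hκf).1 i
  norm_num at h

/-- **H(668): type II of the involution census is empty** (no fixed row and four fixed columns, or the transpose). -/
theorem hadamard668_no_involution_typeII (hH : IsHadamardMatrix H) (hι : Fintype.card ι = 668)
    (haut : IsSignedAut H π κ d e) (hπinv : ∀ i, π (π i) = i) (hκinv : ∀ j, κ (κ j) = j) :
    ¬ (((univ.filter fun i => π i = i).card = 0 ∧ (univ.filter fun j => κ j = j).card = 4 ∧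
        ∑ j ∈ univ.filter (fun j => κ j = j), e j = 0) ∨
       ((univ.filter fun i => π i = i).card = 4 ∧ (univ.filter fun j => κ j = j).card = 0 ∧
        ∑ i ∈ univ.filter (fun i => π i = i), d i = 0)) := by
  have hn8 : Fintype.card ι % 8 = 4 := by rw [hι]
  have hns : ¬ ∃ x y : ℕ, Fintype.card ι = x ^ 2 + y ^ 2 := by rw [hι]; exact not_sq_add_sq_668_nat
  rintro (⟨h0, h4, hs⟩ | ⟨h4, h0, hs⟩)
  · exact no_involution_typeII hH hn8 hns haut hπinv hκinv h0 h4 hs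
  · have hcard : (Fintype.card ι : ℤ) ≠ 0 := by rw [hι]; norm_num
    exact no_involution_typeII (isHadamard_transpose hH hcard) hn8 hns (isSignedAut_transpose haut) hκinv hπinv h0 h4 hs

/-- **H(668) — FINAL INVOLUTION CENSUS.**  For a signed-permutation automorphism `(π, κ, d, e)` of a Hadamard matrix of order
`668` with `π² = κ² = 1` and `(π, κ) ≠ (1, 1)`: `π ≠ 1`, `κ ≠ 1`, and EITHER (type I) `#Fix π = #Fix κ = f` with
`f ≡ 4 (mod 8)`, `4 ≤ f ≤ 332` and one common sign `δ` on all fixed rows and columns, OR (nega type III) no fixed row, no fixed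
column, and `d (π i) = −d i`, `e (κ j) = −e j` for all `i, j`. -/
theorem hadamard668_involution_census_final (hH : IsHadamardMatrix H) (hι : Fintype.card ι = 668)
    (π κ : Equiv.Perm ι) (d e : ι → ℤ) (haut : IsSignedAut H π κ d e)
    (hπ : π ^ 2 = 1) (hκ : κ ^ 2 = 1) (hne : π ≠ 1 ∨ κ ≠ 1) :
    π ≠ 1 ∧ κ ≠ 1 ∧
    (((univ.filter fun i => π i = i).card = (univ.filter fun j => κ j = j).card ∧
        (univ.filter fun i => π i = i).card % 8 = 4 ∧ 4 ≤ (univ.filter fun i => π i = i).card ∧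
        (univ.filter fun i => π i = i).card ≤ 332 ∧
        ∃ δ : ℤ, (δ = 1 ∨ δ = -1) ∧ (∀ i, π i = i → d i = δ) ∧ (∀ j, κ j = j → e j = δ)) ∨
     ((univ.filter fun i => π i = i).card = 0 ∧ (univ.filter fun j => κ j = j).card = 0 ∧
        (∀ i, d (π i) = -d i) ∧ (∀ j, e (κ j) = -e j))) := by
  have hπinv : ∀ i, π (π i) = i := fun i => by
    have := congrArg (fun σ : Equiv.Perm ι => σ i) hπ; simpa [pow_two] using this
  have hκinv : ∀ j, κ (κ j) = j := fun j => by
    have := congrArg (fun σ : Equiv.Perm ι => σ j) hκ; simpa [pow_two] using this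
  obtain ⟨hπ1, hκ1, hcases⟩ := hadamard668_involution_census_mod8 hH hι π κ d e haut hπ hκ hne
  refine ⟨hπ1, hκ1, ?_⟩
  have hII := hadamard668_no_involution_typeII hH hι haut hπinv hκinv
  rcases hcases with hI | hII₁ | hII₂ | ⟨h0r, h0c⟩
  · exact Or.inl hI
  · exact absurd (Or.inl hII₁) hII
  · exact absurd (Or.inr hII₂) hII
  · right
    have hπf : ∀ i, π i ≠ i := by
      intro i hi
      have : i ∈ univ.filter (fun i => π i = i) := by simp [hi]
      rw [Finset.card_eq_zero.mp h0r] at this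
      simp at this
    have hκf : ∀ j, κ j ≠ j := by
      intro j hj
      have : j ∈ univ.filter (fun j => κ j = j) := by simp [hj]
      rw [Finset.card_eq_zero.mp h0c] at this
      simp at this
    exact ⟨h0r, h0c, hadamard668_fpf_involution_nega hH hι haut hπinv hκinv hπf hκf⟩

end h668

end Summit.Ventures.DiscreteObjects.Hadamard
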